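import Literature.NumberTheory.Rogawski1990.AdelicStableOrbitalSupportFiniteH
import Literature.NumberTheory.Automorphic.OrbitalMeasureCentralMass
import HarnessLib

/-!
# The adelic stable orbital integral of `H = U(Φ₂) × U(Φ₁)` at the classes `γ_H = (a·1₂, b)` with SCALAR `U(Φ₂)`-component:
# the `H`-adelic stable class is ONE point, `Φ^st_H(γ_H, f^H) = (mass) · f^H(γ_H ⊗ 1)`
(Rogawski, *Automorphic representations of unitary groups in three variables* (1990), §5.4 pp. 72–73 (5.4.3), Prop. 5.4.1; §14.5 Thm. 14.5.1 (a)
p. 238: among the stable classes `𝒪′_st` of `H` transferring to a SINGULAR semisimple `𝒪_st` of `G` — eigenvalues `{a, a, b}` — are `[(a·1₂, b)]`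
and, for `𝒪_st` central `ζ·1`, `[(ζ·1₂, ζ)]`; at these the `U(Φ₂)`-component is central, every local and the adelic `H`-class is a point, and the
orbital integral is evaluation times the total mass of the (one-point) orbit space)

Topic `NumberTheory/Rogawski1990`; namespaces `Literature.NumberTheory.Automorphic` (§1, §4: generic) and `Literature.NumberTheory.Rogawski1990`
(§2, §3); THEOREMS ONLY (no definition, no instance, no notation, no named fact, no `sorry`).  Brick «H-c» of sub-line O7 of the FLOOR-0 programme
P3a (cell hodgecm-mathlib; O7 OWNER WORD #8 (3)): the anchor of the comparison kit's pins (xi-c) ∕ (xiii″-s) at the scalar-`U(Φ₂)` classes of `H`.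
HC_CM is proved only modulo the printed citations until rung 0 closes.

## What is typed

* §1 GENERIC CENTRAL CLASS (any group `Γ`, `γ` with `∀ g, g γ = γ g`, ANY measure ∕ class-indexed family — extends ★
  `orbitalIntegral_dirac_of_forall_comm`): the orbital integrand `ȳ ↦ F(y γ y⁻¹)` is the constant `F γ` on the one-point orbit space, so
  **`orbitalIntegral γ F μ = (μ univ).toReal • F γ`** (`orbitalIntegral_of_forall_comm`); the class representative `out [γ]` IS `γ`
  (`quotientOut_conjClassesMk_eq_of_forall_comm`); **`classOrbitalIntegral m F [γ] = ((m [γ]) univ).toReal • F γ`** and `= F γ` when that mass is `1`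
  (Dirac ∕ probability normalisation); the one-class stable sum `adelicStableOrbitalSum {[γ]} m f = ((m [γ]) univ).toReal * f γ`.
* §2 RIGIDITY OF SCALAR CLASSES: a scalar `r·1 ∈ U_σ(J)(R)` is alone in its `GL_n(R)`-class, so stable conjugacy to it is equality
  (`eq_of_isStablyConj_of_coe_eq_smul_one`, twin of ★ `eq_of_isStablyConj_fin_one`); scalars stay scalars under `toAdelic`, `toLocal v ∘ toAdelic`,
  `cmRationalToArch` (the definitional matrix identities of ★ `AdelicStableClassSupportFiniteH`), and scalars are central.
* §3 THE `H`-SIDE AT `γ_H = (γ₂, γ₁)` WITH `γ₂ = a·1₂` (binder `hγ : ((γH.1 : U(Φ₂)(L⁺)) : Matrix) = a • 1`; `γ_H ⊗ 1 := (toAdelic γ₂, toAdelic γ₁)`):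
  every `H`-matching adèle IS `γ_H ⊗ 1` (`MatchingAdeleH.adele_fst_eq_of_smul_one`, ★ `MatchingAdeleH.adele_snd_eq`, `MatchingAdeleH.adele_eq_of_smul_one`),
  the diagonal adèle matches (`exists_matchingAdeleH_adele_eq_toAdelic`, no scalar hypothesis), hence
  **`adelicStableClassesOverH L γH = {[γ_H ⊗ 1]}`** (`adelicStableClassesOverH_eq_singleton_of_smul_one`); `γ_H ⊗ 1` is central in `H(𝐀)`
  (`toAdelic_pair_comm_of_smul_one`); and the HEADS **`adelicStableOrbitalIntegralH L γH mH fH = ((mH [γ_H ⊗ 1]) univ).toReal * fH (γ_H ⊗ 1)`**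
  for EVERY family `mH` (`adelicStableOrbitalIntegralH_eq_of_smul_one`) and **`= fH (γ_H ⊗ 1)`** when the family has mass `1` at that class
  (`adelicStableOrbitalIntegralH_eq_apply_of_smul_one`).
* §4 THE MASS OF ★ `OrbitalMeasureFamily.ofLocalAdelicPair` AT A CENTRAL CLASS (generic pair `U(H₂) × U(H₁)`, class `c` whose representative and its
  local ∕ archimedean components are central; admissibility ∕ normalisation binders VERBATIM as ★ `classOrbitalIntegral_ofLocalAdelicPair_eval_eq_mul_prod`):
  **`classOrbitalIntegral (ofLocalAdelicPair mH mHi) F c = ((mHi.atPoint h_∞) univ).toReal * (∏_{v ∈ S₀} ((mH v).atPoint h_v univ).toReal) * F (out c)`**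
  — off `S₀` the local one-point orbit spaces have mass `1` BY the normalisation (the image of `U(H₂)(𝒪_v) × U(H₁)(𝒪_v)` is the point), so the
  «product of masses» is a finite product (`classOrbitalIntegral_ofLocalAdelicPair_of_forall_comm`).

## References
* J. D. Rogawski, *Automorphic Representations of Unitary Groups in Three Variables*, Ann. of Math. Stud. 123 (1990), §3.1 p. 19, §5.4 pp. 72–73,
  §14.5 p. 238 [Rogawski1990].
* A. Deitmar, S. Echterhoff, *Principles of Harmonic Analysis*, 2nd ed. (2014), Thm. 1.5.3 [DeitmarEchterhoff2014].
* S. Gelbart, *Automorphic forms on adele groups* (1975), (9.13), p. 155 (10.19) [Gelbart1975].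
-/

set_option autoImplicit false

noncomputable section

open MeasureTheory Measure Set Filter Topology NumberField IsDedekindDomain
open Literature.MeasureTheory.Group
open scoped ENNReal MatrixGroups

namespace Literature.NumberTheory.Rogawski1990

open Literature.NumberTheory.Automorphic
open Literature.AlgebraicGeometry.ShimuraVarieties (unitaryGroup)

/-! ### §1′ The one-class stable sum at a central class -/

section CentralSum

variable {Γ : Type*} [Group Γ] {γ : Γ} [∀ g : Γ, MeasurableSpace (Γ ⧸ Subgroup.centralizer ({g} : Set Γ))]

/-- **`Φ^st` over the single class of a CENTRAL `γ` is `(m [γ])(univ) · f(γ)`** (★ `adelicStableOrbitalSum_singleton` + §1).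
[cite: Rogawski1990, §5.4 (5.4.3) pp. 72–73] -/
theorem adelicStableOrbitalSum_singleton_mk_of_forall_comm (hγ : ∀ g : Γ, g * γ = γ * g) (m : OrbitalMeasureFamily Γ) (f : Γ → ℂ) :
    adelicStableOrbitalSum ({ConjClasses.mk γ} : Set (ConjClasses Γ)) m f = ((m (ConjClasses.mk γ)) Set.univ).toReal * f γ := by
  rw [adelicStableOrbitalSum_singleton, classOrbitalIntegral_mk_of_forall_comm hγ, Complex.real_smul]

end CentralSum

/-! ## §2 Scalar classes are rigid: stable conjugacy to a scalar is equality; scalars stay scalar and central along the adelic maps -/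

section Scalar

variable {R : Type*} [CommRing R] {n : Type*} [Fintype n] [DecidableEq n] {σ : R →+* R} {J : Matrix n n R}

/-- A scalar matrix `r • 1` commutes with every matrix. [cite: Rogawski1990, §3.1 p. 19] -/
theorem commute_of_coe_eq_smul_one {x : GL n R} {r : R} (hx : ((x : GL n R) : Matrix n n R) = r • (1 : Matrix n n R)) (g : GL n R) :
    g * x = x * g := by
  have h : Commute (g : Matrix n n R) (x : Matrix n n R) := by
    rw [hx]; exact (Commute.one_right _).smul_right r
  exact (Commute.units_val_iff.mp h).eq

/-- **Stable conjugacy TO A SCALAR is equality**: if `x = r • 1` in `U_σ(J)(R) ≤ GL_n(R)` and `y` is stably conjugate to `x` (conjugate in `GL_n(R)`),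
then `y = x` — a scalar is alone in its `GL_n`-class (twin of ★ `eq_of_isStablyConj_fin_one`). [cite: Rogawski1990, §3.1 p. 19] -/
theorem eq_of_isStablyConj_of_coe_eq_smul_one {x y : unitaryGroup σ J} {r : R} (hx : ((x : GL n R) : Matrix n n R) = r • (1 : Matrix n n R))
    (h : IsStablyConj σ J x y) : x = y := by
  obtain ⟨c, hc⟩ := isStablyConj_iff.1 h
  refine Subtype.ext ?_
  rw [← hc, commute_of_coe_eq_smul_one hx c, mul_inv_cancel_right]

omit [Fintype n] in
/-- A scalar matrix stays scalar under an entrywise ring map. [folklore] -/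
private theorem Matrix.smul_one_map {S : Type*} [CommRing S] (f : R →+* S) (r : R) :
    (r • (1 : Matrix n n R)).map f = f r • (1 : Matrix n n S) := by
  rw [Matrix.smul_one_eq_diagonal, Matrix.diagonal_map (map_zero f), Matrix.smul_one_eq_diagonal]

end Scalar

section ScalarCM

variable {L : Type} [Field L] [NumberField L] [IsCMField L] {N : ℕ} {H : Matrix (Fin N) (Fin N) L}
  {γ : (UnitaryGroup.cmDatum L N H).Rational} {a : L}

/-- `γ = a • 1 ⇒ γ ⊗ 1 = (a ⊗ 1) • 1` in `U(H)(𝔸)` (★ `coe_coe_cmDatum_toAdelic_apply`: the adelic matrix is the entrywise diagonal image).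
[cite: BorelJacquet1979, §4.1] -/
theorem coe_coe_cmDatum_toAdelic_eq_smul_one_of_smul_one
    (hγ : (((γ : unitaryGroup (cmConjRingHom L) H).val : GL (Fin N) L) : Matrix (Fin N) (Fin N) L) = a • (1 : Matrix (Fin N) (Fin N) L)) :
    ((((UnitaryGroup.cmDatum L N H).toAdelic γ).val : GL (Fin N) (AdeleRing (𝓞 L) L)) : Matrix (Fin N) (Fin N) (AdeleRing (𝓞 L) L)) =
      algebraMap L (AdeleRing (𝓞 L) L) a • (1 : Matrix (Fin N) (Fin N) (AdeleRing (𝓞 L) L)) := by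
  have e : ((((UnitaryGroup.cmDatum L N H).toAdelic γ).val : GL (Fin N) (AdeleRing (𝓞 L) L)) : Matrix (Fin N) (Fin N) (AdeleRing (𝓞 L) L)) =
      ((((γ : unitaryGroup (cmConjRingHom L) H).val : GL (Fin N) L) : Matrix (Fin N) (Fin N) L)).map (algebraMap L (AdeleRing (𝓞 L) L)) := rfl
  rw [e, hγ, Matrix.smul_one_map]

/-- `γ = a • 1 ⇒ (γ ⊗ 1)_v` is scalar in `U(H)(L⁺_v)` (the local matrix is the entrywise image under ★ `adeleToLocal v`). [cite: PlatonovRapinchuk1994, §5.1] -/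
theorem coe_coe_cmDatum_toLocal_toAdelic_eq_smul_one_of_smul_one
    (hγ : (((γ : unitaryGroup (cmConjRingHom L) H).val : GL (Fin N) L) : Matrix (Fin N) (Fin N) L) = a • (1 : Matrix (Fin N) (Fin N) L))
    (v : HeightOneSpectrum (𝓞 ↥(maximalRealSubfield L))) :
    (((UnitaryGroup.cmDatum L N H).toLocal v ((UnitaryGroup.cmDatum L N H).toAdelic γ)).val.val :
        Matrix (Fin N) (Fin N) (UnitaryGroup.LocalRing L v)) =
      UnitaryGroup.adeleToLocal L v (algebraMap L (AdeleRing (𝓞 L) L) a) • (1 : Matrix (Fin N) (Fin N) (UnitaryGroup.LocalRing L v)) := by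
  have e : (((UnitaryGroup.cmDatum L N H).toLocal v ((UnitaryGroup.cmDatum L N H).toAdelic γ)).val.val :
        Matrix (Fin N) (Fin N) (UnitaryGroup.LocalRing L v)) =
      (((((γ : unitaryGroup (cmConjRingHom L) H).val : GL (Fin N) L) : Matrix (Fin N) (Fin N) L)).map (algebraMap L (AdeleRing (𝓞 L) L))).map
        (UnitaryGroup.adeleToLocal L v) := rfl
  rw [e, hγ, Matrix.smul_one_map, Matrix.smul_one_map]

/-- `γ = a • 1 ⇒ γ ⊗ 1 ∈ U(H)(L ⊗ ℝ)` (★ `cmRationalToArch`) is scalar (the archimedean matrix is the entrywise image under `mixedEmbedding`).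
[cite: BorelJacquet1979, §4.1] -/
theorem coe_coe_cmRationalToArch_eq_smul_one_of_smul_one
    (hγ : (((γ : unitaryGroup (cmConjRingHom L) H).val : GL (Fin N) L) : Matrix (Fin N) (Fin N) L) = a • (1 : Matrix (Fin N) (Fin N) L)) :
    ((cmRationalToArch L N H γ : GL (Fin N) (mixedEmbedding.mixedSpace L)) : Matrix (Fin N) (Fin N) (mixedEmbedding.mixedSpace L)) =
      mixedEmbedding L a • (1 : Matrix (Fin N) (Fin N) (mixedEmbedding.mixedSpace L)) := by
  have e : ((cmRationalToArch L N H γ : GL (Fin N) (mixedEmbedding.mixedSpace L)) : Matrix (Fin N) (Fin N) (mixedEmbedding.mixedSpace L)) =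
      ((((γ : unitaryGroup (cmConjRingHom L) H).val : GL (Fin N) L) : Matrix (Fin N) (Fin N) L)).map (mixedEmbedding L) := rfl
  rw [e, hγ, Matrix.smul_one_map]

/-- `γ = a • 1 ⇒ γ ⊗ 1` is CENTRAL in `U(H)(𝔸)`. [cite: Rogawski1990, §3.1 p. 19] -/
theorem cmDatum_toAdelic_comm_of_smul_one
    (hγ : (((γ : unitaryGroup (cmConjRingHom L) H).val : GL (Fin N) L) : Matrix (Fin N) (Fin N) L) = a • (1 : Matrix (Fin N) (Fin N) L))
    (g : (UnitaryGroup.cmDatum L N H).Adelic) :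
    g * (UnitaryGroup.cmDatum L N H).toAdelic γ = (UnitaryGroup.cmDatum L N H).toAdelic γ * g :=
  Subtype.ext (commute_of_coe_eq_smul_one (coe_coe_cmDatum_toAdelic_eq_smul_one_of_smul_one hγ) g.val)

/-- `γ = a • 1 ⇒ (γ ⊗ 1)_v` is CENTRAL in `U(H)(L⁺_v)`. [cite: Rogawski1990, §3.1 p. 19] -/
theorem cmDatum_toLocal_toAdelic_comm_of_smul_one
    (hγ : (((γ : unitaryGroup (cmConjRingHom L) H).val : GL (Fin N) L) : Matrix (Fin N) (Fin N) L) = a • (1 : Matrix (Fin N) (Fin N) L))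
    (v : HeightOneSpectrum (𝓞 ↥(maximalRealSubfield L))) (g : (UnitaryGroup.cmDatum L N H).Local v) :
    g * (UnitaryGroup.cmDatum L N H).toLocal v ((UnitaryGroup.cmDatum L N H).toAdelic γ) =
      (UnitaryGroup.cmDatum L N H).toLocal v ((UnitaryGroup.cmDatum L N H).toAdelic γ) * g :=
  Subtype.ext (commute_of_coe_eq_smul_one (coe_coe_cmDatum_toLocal_toAdelic_eq_smul_one_of_smul_one hγ v) g.val)

/-- `γ = a • 1 ⇒ γ ⊗ 1` is CENTRAL in `U(H)(L ⊗ ℝ)`. [cite: Rogawski1990, §3.1 p. 19] -/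
theorem cmRationalToArch_comm_of_smul_one
    (hγ : (((γ : unitaryGroup (cmConjRingHom L) H).val : GL (Fin N) L) : Matrix (Fin N) (Fin N) L) = a • (1 : Matrix (Fin N) (Fin N) L))
    (g : ↥(UnitaryGroup.arch (↥(maximalRealSubfield L)) L (IsCMField.complexConj L) N H)) :
    g * cmRationalToArch L N H γ = cmRationalToArch L N H γ * g :=
  Subtype.ext (commute_of_coe_eq_smul_one (coe_coe_cmRationalToArch_eq_smul_one_of_smul_one hγ)
    (g : GL (Fin N) (mixedEmbedding.mixedSpace L)))

/-- In `U(Φ₁)`: EVERY element of `U(J)(𝔸)`, `J` of size `1`, is central (`GL₁` is commutative, ★ `gl_fin_one_comm`). [cite: Rogawski1990, §3.1 p. 19] -/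
theorem cmDatum_adelic_comm_fin_one {J : Matrix (Fin 1) (Fin 1) L} (x g : (UnitaryGroup.cmDatum L 1 J).Adelic) : g * x = x * g :=
  Subtype.ext (gl_fin_one_comm g.val x.val)

/-- In `U(Φ₁)`: every element of `U(J)(L⁺_v)`, `J` of size `1`, is central. [cite: Rogawski1990, §3.1 p. 19] -/
theorem cmDatum_local_comm_fin_one {J : Matrix (Fin 1) (Fin 1) L} (v : HeightOneSpectrum (𝓞 ↥(maximalRealSubfield L)))
    (x g : (UnitaryGroup.cmDatum L 1 J).Local v) : g * x = x * g :=
  Subtype.ext (gl_fin_one_comm g.val x.val)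

/-- In `U(Φ₁)`: every element of `U(J)(L ⊗ ℝ)`, `J` of size `1`, is central. [cite: Rogawski1990, §3.1 p. 19] -/
theorem arch_comm_fin_one {J : Matrix (Fin 1) (Fin 1) L} (x g : ↥(UnitaryGroup.arch (↥(maximalRealSubfield L)) L (IsCMField.complexConj L) 1 J)) :
    g * x = x * g :=
  Subtype.ext (gl_fin_one_comm (g : GL (Fin 1) (mixedEmbedding.mixedSpace L)) (x : GL (Fin 1) (mixedEmbedding.mixedSpace L)))

end ScalarCM

/-! ## §3 `H = U(Φ₂) × U(Φ₁)` at `γ_H = (a·1₂, b)`: one matching adèle, one class, `Φ^st_H = (mass) · f^H(γ_H ⊗ 1)` -/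

section CentralH

variable {L : Type} [Field L] [NumberField L] [IsCMField L]
variable {γH : (UnitaryGroup.cmDatum L 2 (Matrix.of fun i j : Fin 2 => if i.val + j.val + 1 = 2 then (1 : L) else 0)).Rational ×
  (UnitaryGroup.cmDatum L 1 (Matrix.of fun i j : Fin 1 => if i.val + j.val + 1 = 1 then (1 : L) else 0)).Rational} {a : L}

/-- **The diagonal adèle `γ_H ⊗ 1 = (toAdelic γ₂, toAdelic γ₁)` is `H`-matching** (stable conjugacy is reflexive at every place; ★ `archPart_cmDatum_toAdelic`
at `∞`) — NO hypothesis on `γ_H`. [cite: Rogawski1990, §3.3 p. 21; §5.4 p. 72] -/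
theorem exists_matchingAdeleH_adele_eq_toAdelic (γH : (UnitaryGroup.cmDatum L 2 (Matrix.of fun i j : Fin 2 => if i.val + j.val + 1 = 2 then (1 : L) else 0)).Rational ×
      (UnitaryGroup.cmDatum L 1 (Matrix.of fun i j : Fin 1 => if i.val + j.val + 1 = 1 then (1 : L) else 0)).Rational) :
    ∃ p : MatchingAdeleH L γH, p.adele =
      ((UnitaryGroup.cmDatum L 2 (Matrix.of fun i j : Fin 2 => if i.val + j.val + 1 = 2 then (1 : L) else 0)).toAdelic γH.1,
        (UnitaryGroup.cmDatum L 1 (Matrix.of fun i j : Fin 1 => if i.val + j.val + 1 = 1 then (1 : L) else 0)).toAdelic γH.2) := by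
  refine ⟨⟨((UnitaryGroup.cmDatum L 2 (Matrix.of fun i j : Fin 2 => if i.val + j.val + 1 = 2 then (1 : L) else 0)).toAdelic γH.1,
      (UnitaryGroup.cmDatum L 1 (Matrix.of fun i j : Fin 1 => if i.val + j.val + 1 = 1 then (1 : L) else 0)).toAdelic γH.2),
    fun v => IsStablyConjH.refl _ _ _ _, ?_⟩, rfl⟩
  rw [archPart_cmDatum_toAdelic, archPart_cmDatum_toAdelic]
  exact IsStablyConjH.refl _ _ _ _

/-- `[γ_H ⊗ 1] ∈ 𝒞′_𝐀(γ_H)` — the `H`-adelic stable class over `γ_H` is never empty. [cite: Rogawski1990, §5.4 p. 72] -/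
theorem conjClassesMk_toAdelic_mem_adelicStableClassesOverH (γH : (UnitaryGroup.cmDatum L 2 (Matrix.of fun i j : Fin 2 => if i.val + j.val + 1 = 2 then (1 : L) else 0)).Rational ×
      (UnitaryGroup.cmDatum L 1 (Matrix.of fun i j : Fin 1 => if i.val + j.val + 1 = 1 then (1 : L) else 0)).Rational) :
    ConjClasses.mk ((UnitaryGroup.cmDatum L 2 (Matrix.of fun i j : Fin 2 => if i.val + j.val + 1 = 2 then (1 : L) else 0)).toAdelic γH.1,
        (UnitaryGroup.cmDatum L 1 (Matrix.of fun i j : Fin 1 => if i.val + j.val + 1 = 1 then (1 : L) else 0)).toAdelic γH.2) ∈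
      adelicStableClassesOverH L γH := by
  obtain ⟨p, hp⟩ := exists_matchingAdeleH_adele_eq_toAdelic γH
  exact ⟨p, congrArg ConjClasses.mk hp⟩

/-- **The `U(Φ₂)`-component of an `H`-matching adèle over `γ_H = (a·1₂, γ₁)` IS `(a·1₂) ⊗ 1`**: at every finite place and at `∞` it is stably conjugate
to a scalar, hence equal to it (§2), hence globally (★ `UnitaryGroup.eq_of_archPart_eq_of_forall_toLocal_eq`). [cite: Rogawski1990, §3.3 p. 21; §5.4 p. 72] -/
theorem MatchingAdeleH.adele_fst_eq_of_smul_one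
    (hγ : (((γH.1 : unitaryGroup (cmConjRingHom L) (Matrix.of fun i j : Fin 2 => if i.val + j.val + 1 = 2 then (1 : L) else 0)).val : GL (Fin 2) L) :
      Matrix (Fin 2) (Fin 2) L) = a • (1 : Matrix (Fin 2) (Fin 2) L))
    (p : MatchingAdeleH L γH) :
    p.adele.1 = (UnitaryGroup.cmDatum L 2 (Matrix.of fun i j : Fin 2 => if i.val + j.val + 1 = 2 then (1 : L) else 0)).toAdelic γH.1 := by
  refine UnitaryGroup.eq_of_archPart_eq_of_forall_toLocal_eq (↥(maximalRealSubfield L)) L (IsCMField.complexConj L) 2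
    (Matrix.of fun i j : Fin 2 => if i.val + j.val + 1 = 2 then (1 : L) else 0) ?_ fun v => ?_
  · rw [archPart_cmDatum_toAdelic]
    exact (eq_of_isStablyConj_of_coe_eq_smul_one (coe_coe_cmRationalToArch_eq_smul_one_of_smul_one hγ) p.isArchStablyConjH.1).symm
  · exact (eq_of_isStablyConj_of_coe_eq_smul_one (coe_coe_cmDatum_toLocal_toAdelic_eq_smul_one_of_smul_one hγ v) (p.isLocalStablyConjH v).1).symm

/-- **Every `H`-matching adèle over `γ_H = (a·1₂, γ₁)` IS `γ_H ⊗ 1`** (`adele_fst_eq_of_smul_one` and ★ `MatchingAdeleH.adele_snd_eq`).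
[cite: Rogawski1990, §3.3 p. 21; §5.4 p. 72] -/
theorem MatchingAdeleH.adele_eq_of_smul_one
    (hγ : (((γH.1 : unitaryGroup (cmConjRingHom L) (Matrix.of fun i j : Fin 2 => if i.val + j.val + 1 = 2 then (1 : L) else 0)).val : GL (Fin 2) L) :
      Matrix (Fin 2) (Fin 2) L) = a • (1 : Matrix (Fin 2) (Fin 2) L))
    (p : MatchingAdeleH L γH) :
    p.adele = ((UnitaryGroup.cmDatum L 2 (Matrix.of fun i j : Fin 2 => if i.val + j.val + 1 = 2 then (1 : L) else 0)).toAdelic γH.1,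
      (UnitaryGroup.cmDatum L 1 (Matrix.of fun i j : Fin 1 => if i.val + j.val + 1 = 1 then (1 : L) else 0)).toAdelic γH.2) :=
  Prod.ext (p.adele_fst_eq_of_smul_one hγ) p.adele_snd_eq

/-- **`𝒞′_𝐀(γ_H) = {[γ_H ⊗ 1]}` at `γ_H = (a·1₂, γ₁)`**: the `H`-adelic stable class over a rational class with scalar `U(Φ₂)`-component is ONE
`H(𝐀)`-class. [cite: Rogawski1990, §5.4 p. 72; §14.5 p. 238] -/
theorem adelicStableClassesOverH_eq_singleton_of_smul_one
    (hγ : (((γH.1 : unitaryGroup (cmConjRingHom L) (Matrix.of fun i j : Fin 2 => if i.val + j.val + 1 = 2 then (1 : L) else 0)).val : GL (Fin 2) L) :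
      Matrix (Fin 2) (Fin 2) L) = a • (1 : Matrix (Fin 2) (Fin 2) L)) :
    adelicStableClassesOverH L γH =
      {ConjClasses.mk ((UnitaryGroup.cmDatum L 2 (Matrix.of fun i j : Fin 2 => if i.val + j.val + 1 = 2 then (1 : L) else 0)).toAdelic γH.1,
        (UnitaryGroup.cmDatum L 1 (Matrix.of fun i j : Fin 1 => if i.val + j.val + 1 = 1 then (1 : L) else 0)).toAdelic γH.2)} := by
  refine Set.Subset.antisymm ?_ (Set.singleton_subset_iff.2 (conjClassesMk_toAdelic_mem_adelicStableClassesOverH γH))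
  rintro c ⟨p, rfl⟩
  exact Set.mem_singleton_iff.2 (congrArg ConjClasses.mk (p.adele_eq_of_smul_one hγ))

/-- **`γ_H ⊗ 1` is CENTRAL in `H(𝐀)`** at `γ_H = (a·1₂, γ₁)` (the `U(Φ₂)`-coordinate is scalar, the `U(Φ₁)`-coordinate lives in a commutative group).
[cite: Rogawski1990, §3.1 p. 19; §14.5 p. 238] -/
theorem toAdelic_pair_comm_of_smul_one
    (hγ : (((γH.1 : unitaryGroup (cmConjRingHom L) (Matrix.of fun i j : Fin 2 => if i.val + j.val + 1 = 2 then (1 : L) else 0)).val : GL (Fin 2) L) :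
      Matrix (Fin 2) (Fin 2) L) = a • (1 : Matrix (Fin 2) (Fin 2) L))
    (g : (UnitaryGroup.cmDatum L 2 (Matrix.of fun i j : Fin 2 => if i.val + j.val + 1 = 2 then (1 : L) else 0)).Adelic ×
      (UnitaryGroup.cmDatum L 1 (Matrix.of fun i j : Fin 1 => if i.val + j.val + 1 = 1 then (1 : L) else 0)).Adelic) :
    g * ((UnitaryGroup.cmDatum L 2 (Matrix.of fun i j : Fin 2 => if i.val + j.val + 1 = 2 then (1 : L) else 0)).toAdelic γH.1,
        (UnitaryGroup.cmDatum L 1 (Matrix.of fun i j : Fin 1 => if i.val + j.val + 1 = 1 then (1 : L) else 0)).toAdelic γH.2) =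
      ((UnitaryGroup.cmDatum L 2 (Matrix.of fun i j : Fin 2 => if i.val + j.val + 1 = 2 then (1 : L) else 0)).toAdelic γH.1,
        (UnitaryGroup.cmDatum L 1 (Matrix.of fun i j : Fin 1 => if i.val + j.val + 1 = 1 then (1 : L) else 0)).toAdelic γH.2) * g :=
  Prod.ext (cmDatum_toAdelic_comm_of_smul_one hγ g.1) (cmDatum_adelic_comm_fin_one _ g.2)

variable [∀ h : (UnitaryGroup.cmDatum L 2 (Matrix.of fun i j : Fin 2 => if i.val + j.val + 1 = 2 then (1 : L) else 0)).Adelic ×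
    (UnitaryGroup.cmDatum L 1 (Matrix.of fun i j : Fin 1 => if i.val + j.val + 1 = 1 then (1 : L) else 0)).Adelic,
  MeasurableSpace (((UnitaryGroup.cmDatum L 2 (Matrix.of fun i j : Fin 2 => if i.val + j.val + 1 = 2 then (1 : L) else 0)).Adelic ×
    (UnitaryGroup.cmDatum L 1 (Matrix.of fun i j : Fin 1 => if i.val + j.val + 1 = 1 then (1 : L) else 0)).Adelic) ⧸
    Subgroup.centralizer ({h} : Set ((UnitaryGroup.cmDatum L 2 (Matrix.of fun i j : Fin 2 => if i.val + j.val + 1 = 2 then (1 : L) else 0)).Adelic ×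
      (UnitaryGroup.cmDatum L 1 (Matrix.of fun i j : Fin 1 => if i.val + j.val + 1 = 1 then (1 : L) else 0)).Adelic)))]

/-- **HEAD — `Φ^st_H(γ_H, f^H) = (mass of the orbit-space point) · f^H(γ_H ⊗ 1)` at `γ_H = (a·1₂, γ₁)`, for EVERY class-indexed orbital measure family `mH`
on `H(𝐀)`**: one class (`adelicStableClassesOverH_eq_singleton_of_smul_one`), central representative (§1). [cite: Rogawski1990, §5.4 (5.4.3) pp. 72–73; §14.5 p. 238] -/
theorem adelicStableOrbitalIntegralH_eq_of_smul_one
    (hγ : (((γH.1 : unitaryGroup (cmConjRingHom L) (Matrix.of fun i j : Fin 2 => if i.val + j.val + 1 = 2 then (1 : L) else 0)).val : GL (Fin 2) L) :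
      Matrix (Fin 2) (Fin 2) L) = a • (1 : Matrix (Fin 2) (Fin 2) L))
    (mH : OrbitalMeasureFamily ((UnitaryGroup.cmDatum L 2 (Matrix.of fun i j : Fin 2 => if i.val + j.val + 1 = 2 then (1 : L) else 0)).Adelic ×
      (UnitaryGroup.cmDatum L 1 (Matrix.of fun i j : Fin 1 => if i.val + j.val + 1 = 1 then (1 : L) else 0)).Adelic))
    (fH : (UnitaryGroup.cmDatum L 2 (Matrix.of fun i j : Fin 2 => if i.val + j.val + 1 = 2 then (1 : L) else 0)).Adelic ×
      (UnitaryGroup.cmDatum L 1 (Matrix.of fun i j : Fin 1 => if i.val + j.val + 1 = 1 then (1 : L) else 0)).Adelic → ℂ) :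
    adelicStableOrbitalIntegralH L γH mH fH =
      ((mH (ConjClasses.mk ((UnitaryGroup.cmDatum L 2 (Matrix.of fun i j : Fin 2 => if i.val + j.val + 1 = 2 then (1 : L) else 0)).toAdelic γH.1,
          (UnitaryGroup.cmDatum L 1 (Matrix.of fun i j : Fin 1 => if i.val + j.val + 1 = 1 then (1 : L) else 0)).toAdelic γH.2))) Set.univ).toReal *
        fH ((UnitaryGroup.cmDatum L 2 (Matrix.of fun i j : Fin 2 => if i.val + j.val + 1 = 2 then (1 : L) else 0)).toAdelic γH.1,
          (UnitaryGroup.cmDatum L 1 (Matrix.of fun i j : Fin 1 => if i.val + j.val + 1 = 1 then (1 : L) else 0)).toAdelic γH.2) := by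
  rw [adelicStableOrbitalIntegralH, adelicStableClassesOverH_eq_singleton_of_smul_one hγ,
    adelicStableOrbitalSum_singleton_mk_of_forall_comm (toAdelic_pair_comm_of_smul_one hγ)]

/-- **HEAD (mass-one normalisation) — `Φ^st_H(γ_H, f^H) = f^H(γ_H ⊗ 1)` at `γ_H = (a·1₂, γ₁)`** when the family gives the one-point orbit space of
`[γ_H ⊗ 1]` mass `1` (the Dirac ∕ probability normalisation at the central classes, ★ `exists_smulInvariantMeasure_quotient_centralizer_of_forall_comm_top`).
[cite: Rogawski1990, §5.4 (5.4.3) pp. 72–73; §14.5 p. 238] -/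
theorem adelicStableOrbitalIntegralH_eq_apply_of_smul_one
    (hγ : (((γH.1 : unitaryGroup (cmConjRingHom L) (Matrix.of fun i j : Fin 2 => if i.val + j.val + 1 = 2 then (1 : L) else 0)).val : GL (Fin 2) L) :
      Matrix (Fin 2) (Fin 2) L) = a • (1 : Matrix (Fin 2) (Fin 2) L))
    (mH : OrbitalMeasureFamily ((UnitaryGroup.cmDatum L 2 (Matrix.of fun i j : Fin 2 => if i.val + j.val + 1 = 2 then (1 : L) else 0)).Adelic ×
      (UnitaryGroup.cmDatum L 1 (Matrix.of fun i j : Fin 1 => if i.val + j.val + 1 = 1 then (1 : L) else 0)).Adelic))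
    (fH : (UnitaryGroup.cmDatum L 2 (Matrix.of fun i j : Fin 2 => if i.val + j.val + 1 = 2 then (1 : L) else 0)).Adelic ×
      (UnitaryGroup.cmDatum L 1 (Matrix.of fun i j : Fin 1 => if i.val + j.val + 1 = 1 then (1 : L) else 0)).Adelic → ℂ)
    (h1 : mH (ConjClasses.mk ((UnitaryGroup.cmDatum L 2 (Matrix.of fun i j : Fin 2 => if i.val + j.val + 1 = 2 then (1 : L) else 0)).toAdelic γH.1,
        (UnitaryGroup.cmDatum L 1 (Matrix.of fun i j : Fin 1 => if i.val + j.val + 1 = 1 then (1 : L) else 0)).toAdelic γH.2)) Set.univ = 1) :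
    adelicStableOrbitalIntegralH L γH mH fH =
      fH ((UnitaryGroup.cmDatum L 2 (Matrix.of fun i j : Fin 2 => if i.val + j.val + 1 = 2 then (1 : L) else 0)).toAdelic γH.1,
        (UnitaryGroup.cmDatum L 1 (Matrix.of fun i j : Fin 1 => if i.val + j.val + 1 = 1 then (1 : L) else 0)).toAdelic γH.2) := by
  rw [adelicStableOrbitalIntegralH_eq_of_smul_one hγ, h1, ENNReal.toReal_one, Complex.ofReal_one, one_mul]

end CentralH

/-! ### §3.1 The same for the class-indexed family ★ `OrbitalMeasureFamily.ofLocalAdelicPair mH mHi` built from local families: the product of masses -/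

section CentralHOfLocal

variable {L : Type} [Field L] [NumberField L] [IsCMField L]
variable {γH : (UnitaryGroup.cmDatum L 2 (Matrix.of fun i j : Fin 2 => if i.val + j.val + 1 = 2 then (1 : L) else 0)).Rational ×
  (UnitaryGroup.cmDatum L 1 (Matrix.of fun i j : Fin 1 => if i.val + j.val + 1 = 1 then (1 : L) else 0)).Rational} {a : L}

variable
  [∀ (v : HeightOneSpectrum (𝓞 ↥(maximalRealSubfield L))) (x : UnitaryGroup.pairLocal L (Matrix.of fun i j : Fin 2 => if i.val + j.val + 1 = 2 then (1 : L) else 0) (Matrix.of fun i j : Fin 1 => if i.val + j.val + 1 = 1 then (1 : L) else 0) v),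
    MeasurableSpace (UnitaryGroup.pairLocal L (Matrix.of fun i j : Fin 2 => if i.val + j.val + 1 = 2 then (1 : L) else 0) (Matrix.of fun i j : Fin 1 => if i.val + j.val + 1 = 1 then (1 : L) else 0) v ⧸
      Subgroup.centralizer ({x} : Set (UnitaryGroup.pairLocal L (Matrix.of fun i j : Fin 2 => if i.val + j.val + 1 = 2 then (1 : L) else 0) (Matrix.of fun i j : Fin 1 => if i.val + j.val + 1 = 1 then (1 : L) else 0) v)))]
  [∀ h : UnitaryGroup.pairAdelic L (Matrix.of fun i j : Fin 2 => if i.val + j.val + 1 = 2 then (1 : L) else 0) (Matrix.of fun i j : Fin 1 => if i.val + j.val + 1 = 1 then (1 : L) else 0),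
    MeasurableSpace (UnitaryGroup.pairAdelic L (Matrix.of fun i j : Fin 2 => if i.val + j.val + 1 = 2 then (1 : L) else 0) (Matrix.of fun i j : Fin 1 => if i.val + j.val + 1 = 1 then (1 : L) else 0) ⧸ Subgroup.centralizer ({h} : Set (UnitaryGroup.pairAdelic L (Matrix.of fun i j : Fin 2 => if i.val + j.val + 1 = 2 then (1 : L) else 0) (Matrix.of fun i j : Fin 1 => if i.val + j.val + 1 = 1 then (1 : L) else 0))))]
  [∀ b : UnitaryGroup.pairArch L (Matrix.of fun i j : Fin 2 => if i.val + j.val + 1 = 2 then (1 : L) else 0) (Matrix.of fun i j : Fin 1 => if i.val + j.val + 1 = 1 then (1 : L) else 0),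
    MeasurableSpace (UnitaryGroup.pairArch L (Matrix.of fun i j : Fin 2 => if i.val + j.val + 1 = 2 then (1 : L) else 0) (Matrix.of fun i j : Fin 1 => if i.val + j.val + 1 = 1 then (1 : L) else 0) ⧸ Subgroup.centralizer ({b} : Set (UnitaryGroup.pairArch L (Matrix.of fun i j : Fin 2 => if i.val + j.val + 1 = 2 then (1 : L) else 0) (Matrix.of fun i j : Fin 1 => if i.val + j.val + 1 = 1 then (1 : L) else 0))))]
  [∀ (v : HeightOneSpectrum (𝓞 ↥(maximalRealSubfield L))) (x : UnitaryGroup.pairLocal L (Matrix.of fun i j : Fin 2 => if i.val + j.val + 1 = 2 then (1 : L) else 0) (Matrix.of fun i j : Fin 1 => if i.val + j.val + 1 = 1 then (1 : L) else 0) v),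
    BorelSpace (UnitaryGroup.pairLocal L (Matrix.of fun i j : Fin 2 => if i.val + j.val + 1 = 2 then (1 : L) else 0) (Matrix.of fun i j : Fin 1 => if i.val + j.val + 1 = 1 then (1 : L) else 0) v ⧸
      Subgroup.centralizer ({x} : Set (UnitaryGroup.pairLocal L (Matrix.of fun i j : Fin 2 => if i.val + j.val + 1 = 2 then (1 : L) else 0) (Matrix.of fun i j : Fin 1 => if i.val + j.val + 1 = 1 then (1 : L) else 0) v)))]
  [∀ h : UnitaryGroup.pairAdelic L (Matrix.of fun i j : Fin 2 => if i.val + j.val + 1 = 2 then (1 : L) else 0) (Matrix.of fun i j : Fin 1 => if i.val + j.val + 1 = 1 then (1 : L) else 0),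
    BorelSpace (UnitaryGroup.pairAdelic L (Matrix.of fun i j : Fin 2 => if i.val + j.val + 1 = 2 then (1 : L) else 0) (Matrix.of fun i j : Fin 1 => if i.val + j.val + 1 = 1 then (1 : L) else 0) ⧸ Subgroup.centralizer ({h} : Set (UnitaryGroup.pairAdelic L (Matrix.of fun i j : Fin 2 => if i.val + j.val + 1 = 2 then (1 : L) else 0) (Matrix.of fun i j : Fin 1 => if i.val + j.val + 1 = 1 then (1 : L) else 0))))]
  [∀ b : UnitaryGroup.pairArch L (Matrix.of fun i j : Fin 2 => if i.val + j.val + 1 = 2 then (1 : L) else 0) (Matrix.of fun i j : Fin 1 => if i.val + j.val + 1 = 1 then (1 : L) else 0),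
    BorelSpace (UnitaryGroup.pairArch L (Matrix.of fun i j : Fin 2 => if i.val + j.val + 1 = 2 then (1 : L) else 0) (Matrix.of fun i j : Fin 1 => if i.val + j.val + 1 = 1 then (1 : L) else 0) ⧸ Subgroup.centralizer ({b} : Set (UnitaryGroup.pairArch L (Matrix.of fun i j : Fin 2 => if i.val + j.val + 1 = 2 then (1 : L) else 0) (Matrix.of fun i j : Fin 1 => if i.val + j.val + 1 = 1 then (1 : L) else 0))))]

/-- **HEAD for ★ `ofLocalAdelicPair` — `Φ^st_H(γ_H; ofLocalAdelicPair mH mHi; f^H) = (mHi-mass at (γ_H ⊗ 1)_∞) · (∏_{v ∈ S₀} mH v-mass at (γ_H ⊗ 1)_v) · f^H(γ_H ⊗ 1)`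
at `γ_H = (a·1₂, γ₁)`**, the local families admissible at the local classes of `γ_H ⊗ 1` and normalised off `S₀` there (binders VERBATIM as ★
`classOrbitalIntegral_ofLocalAdelicPair_eval_eq_mul_prod`, at the representative `out [γ_H ⊗ 1]` — which IS `γ_H ⊗ 1`,
`quotientOut_conjClassesMk_eq_of_forall_comm`): one class (§3), central representative with central local components (§2), ★
`classOrbitalIntegral_ofLocalAdelicPair_of_forall_comm`.  With the masses normalised to `1` at these classes this is `f^H(γ_H ⊗ 1)`.
[cite: Rogawski1990, §5.4 (5.4.3) pp. 72–73; §14.5 p. 238] -/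
theorem adelicStableOrbitalIntegralH_ofLocalAdelicPair_eq_of_smul_one
    (hγ : (((γH.1 : unitaryGroup (cmConjRingHom L) (Matrix.of fun i j : Fin 2 => if i.val + j.val + 1 = 2 then (1 : L) else 0)).val : GL (Fin 2) L) :
      Matrix (Fin 2) (Fin 2) L) = a • (1 : Matrix (Fin 2) (Fin 2) L))
    (mH : ∀ v : HeightOneSpectrum (𝓞 ↥(maximalRealSubfield L)), OrbitalMeasureFamily (UnitaryGroup.pairLocal L (Matrix.of fun i j : Fin 2 => if i.val + j.val + 1 = 2 then (1 : L) else 0) (Matrix.of fun i j : Fin 1 => if i.val + j.val + 1 = 1 then (1 : L) else 0) v))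
    (mHi : OrbitalMeasureFamily (UnitaryGroup.pairArch L (Matrix.of fun i j : Fin 2 => if i.val + j.val + 1 = 2 then (1 : L) else 0) (Matrix.of fun i j : Fin 1 => if i.val + j.val + 1 = 1 then (1 : L) else 0)))
    {S₀ : Finset (HeightOneSpectrum (𝓞 ↥(maximalRealSubfield L)))}
    (hS₀ : UnitaryGroup.IsNormalisedOffPair L (Matrix.of fun i j : Fin 2 => if i.val + j.val + 1 = 2 then (1 : L) else 0) (Matrix.of fun i j : Fin 1 => if i.val + j.val + 1 = 1 then (1 : L) else 0) mH
      (Quotient.out (ConjClasses.mk ((UnitaryGroup.cmDatum L 2 (Matrix.of fun i j : Fin 2 => if i.val + j.val + 1 = 2 then (1 : L) else 0)).toAdelic γH.1,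
          (UnitaryGroup.cmDatum L 1 (Matrix.of fun i j : Fin 1 => if i.val + j.val + 1 = 1 then (1 : L) else 0)).toAdelic γH.2)) : UnitaryGroup.pairAdelic L (Matrix.of fun i j : Fin 2 => if i.val + j.val + 1 = 2 then (1 : L) else 0) (Matrix.of fun i j : Fin 1 => if i.val + j.val + 1 = 1 then (1 : L) else 0)) S₀)
    (hadm : ∀ v, mH v (ConjClasses.mk (UnitaryGroup.pairToLocal L (Matrix.of fun i j : Fin 2 => if i.val + j.val + 1 = 2 then (1 : L) else 0) (Matrix.of fun i j : Fin 1 => if i.val + j.val + 1 = 1 then (1 : L) else 0) v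
        (Quotient.out (ConjClasses.mk ((UnitaryGroup.cmDatum L 2 (Matrix.of fun i j : Fin 2 => if i.val + j.val + 1 = 2 then (1 : L) else 0)).toAdelic γH.1,
          (UnitaryGroup.cmDatum L 1 (Matrix.of fun i j : Fin 1 => if i.val + j.val + 1 = 1 then (1 : L) else 0)).toAdelic γH.2)) : UnitaryGroup.pairAdelic L (Matrix.of fun i j : Fin 2 => if i.val + j.val + 1 = 2 then (1 : L) else 0) (Matrix.of fun i j : Fin 1 => if i.val + j.val + 1 = 1 then (1 : L) else 0)))) ≠ 0 ∧
      SMulInvariantMeasure (UnitaryGroup.pairLocal L (Matrix.of fun i j : Fin 2 => if i.val + j.val + 1 = 2 then (1 : L) else 0) (Matrix.of fun i j : Fin 1 => if i.val + j.val + 1 = 1 then (1 : L) else 0) v) _ (mH v (ConjClasses.mk (UnitaryGroup.pairToLocal L (Matrix.of fun i j : Fin 2 => if i.val + j.val + 1 = 2 then (1 : L) else 0) (Matrix.of fun i j : Fin 1 => if i.val + j.val + 1 = 1 then (1 : L) else 0) v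
        (Quotient.out (ConjClasses.mk ((UnitaryGroup.cmDatum L 2 (Matrix.of fun i j : Fin 2 => if i.val + j.val + 1 = 2 then (1 : L) else 0)).toAdelic γH.1,
          (UnitaryGroup.cmDatum L 1 (Matrix.of fun i j : Fin 1 => if i.val + j.val + 1 = 1 then (1 : L) else 0)).toAdelic γH.2)) : UnitaryGroup.pairAdelic L (Matrix.of fun i j : Fin 2 => if i.val + j.val + 1 = 2 then (1 : L) else 0) (Matrix.of fun i j : Fin 1 => if i.val + j.val + 1 = 1 then (1 : L) else 0))))) ∧
      IsFiniteMeasureOnCompacts (mH v (ConjClasses.mk (UnitaryGroup.pairToLocal L (Matrix.of fun i j : Fin 2 => if i.val + j.val + 1 = 2 then (1 : L) else 0) (Matrix.of fun i j : Fin 1 => if i.val + j.val + 1 = 1 then (1 : L) else 0) v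
        (Quotient.out (ConjClasses.mk ((UnitaryGroup.cmDatum L 2 (Matrix.of fun i j : Fin 2 => if i.val + j.val + 1 = 2 then (1 : L) else 0)).toAdelic γH.1,
          (UnitaryGroup.cmDatum L 1 (Matrix.of fun i j : Fin 1 => if i.val + j.val + 1 = 1 then (1 : L) else 0)).toAdelic γH.2)) : UnitaryGroup.pairAdelic L (Matrix.of fun i j : Fin 2 => if i.val + j.val + 1 = 2 then (1 : L) else 0) (Matrix.of fun i j : Fin 1 => if i.val + j.val + 1 = 1 then (1 : L) else 0))))))
    (hadmA : mHi (ConjClasses.mk (UnitaryGroup.pairArchPart L (Matrix.of fun i j : Fin 2 => if i.val + j.val + 1 = 2 then (1 : L) else 0) (Matrix.of fun i j : Fin 1 => if i.val + j.val + 1 = 1 then (1 : L) else 0)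
        (Quotient.out (ConjClasses.mk ((UnitaryGroup.cmDatum L 2 (Matrix.of fun i j : Fin 2 => if i.val + j.val + 1 = 2 then (1 : L) else 0)).toAdelic γH.1,
          (UnitaryGroup.cmDatum L 1 (Matrix.of fun i j : Fin 1 => if i.val + j.val + 1 = 1 then (1 : L) else 0)).toAdelic γH.2)) : UnitaryGroup.pairAdelic L (Matrix.of fun i j : Fin 2 => if i.val + j.val + 1 = 2 then (1 : L) else 0) (Matrix.of fun i j : Fin 1 => if i.val + j.val + 1 = 1 then (1 : L) else 0)))) ≠ 0 ∧
      SMulInvariantMeasure (UnitaryGroup.pairArch L (Matrix.of fun i j : Fin 2 => if i.val + j.val + 1 = 2 then (1 : L) else 0) (Matrix.of fun i j : Fin 1 => if i.val + j.val + 1 = 1 then (1 : L) else 0)) _ (mHi (ConjClasses.mk (UnitaryGroup.pairArchPart L (Matrix.of fun i j : Fin 2 => if i.val + j.val + 1 = 2 then (1 : L) else 0) (Matrix.of fun i j : Fin 1 => if i.val + j.val + 1 = 1 then (1 : L) else 0)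
        (Quotient.out (ConjClasses.mk ((UnitaryGroup.cmDatum L 2 (Matrix.of fun i j : Fin 2 => if i.val + j.val + 1 = 2 then (1 : L) else 0)).toAdelic γH.1,
          (UnitaryGroup.cmDatum L 1 (Matrix.of fun i j : Fin 1 => if i.val + j.val + 1 = 1 then (1 : L) else 0)).toAdelic γH.2)) : UnitaryGroup.pairAdelic L (Matrix.of fun i j : Fin 2 => if i.val + j.val + 1 = 2 then (1 : L) else 0) (Matrix.of fun i j : Fin 1 => if i.val + j.val + 1 = 1 then (1 : L) else 0))))) ∧
      IsFiniteMeasureOnCompacts (mHi (ConjClasses.mk (UnitaryGroup.pairArchPart L (Matrix.of fun i j : Fin 2 => if i.val + j.val + 1 = 2 then (1 : L) else 0) (Matrix.of fun i j : Fin 1 => if i.val + j.val + 1 = 1 then (1 : L) else 0)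
        (Quotient.out (ConjClasses.mk ((UnitaryGroup.cmDatum L 2 (Matrix.of fun i j : Fin 2 => if i.val + j.val + 1 = 2 then (1 : L) else 0)).toAdelic γH.1,
          (UnitaryGroup.cmDatum L 1 (Matrix.of fun i j : Fin 1 => if i.val + j.val + 1 = 1 then (1 : L) else 0)).toAdelic γH.2)) : UnitaryGroup.pairAdelic L (Matrix.of fun i j : Fin 2 => if i.val + j.val + 1 = 2 then (1 : L) else 0) (Matrix.of fun i j : Fin 1 => if i.val + j.val + 1 = 1 then (1 : L) else 0))))))
    (fH : UnitaryGroup.pairAdelic L (Matrix.of fun i j : Fin 2 => if i.val + j.val + 1 = 2 then (1 : L) else 0) (Matrix.of fun i j : Fin 1 => if i.val + j.val + 1 = 1 then (1 : L) else 0) → ℂ) :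
    adelicStableOrbitalIntegralH L γH (UnitaryGroup.OrbitalMeasureFamily.ofLocalAdelicPair L (Matrix.of fun i j : Fin 2 => if i.val + j.val + 1 = 2 then (1 : L) else 0) (Matrix.of fun i j : Fin 1 => if i.val + j.val + 1 = 1 then (1 : L) else 0) mH mHi) fH =
      ((mHi.atPoint (UnitaryGroup.pairArchPart L (Matrix.of fun i j : Fin 2 => if i.val + j.val + 1 = 2 then (1 : L) else 0) (Matrix.of fun i j : Fin 1 => if i.val + j.val + 1 = 1 then (1 : L) else 0)
          (Quotient.out (ConjClasses.mk ((UnitaryGroup.cmDatum L 2 (Matrix.of fun i j : Fin 2 => if i.val + j.val + 1 = 2 then (1 : L) else 0)).toAdelic γH.1,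
          (UnitaryGroup.cmDatum L 1 (Matrix.of fun i j : Fin 1 => if i.val + j.val + 1 = 1 then (1 : L) else 0)).toAdelic γH.2)) : UnitaryGroup.pairAdelic L (Matrix.of fun i j : Fin 2 => if i.val + j.val + 1 = 2 then (1 : L) else 0) (Matrix.of fun i j : Fin 1 => if i.val + j.val + 1 = 1 then (1 : L) else 0))) Set.univ).toReal : ℂ) *
        (∏ v ∈ S₀, (((mH v).atPoint (UnitaryGroup.pairToLocal L (Matrix.of fun i j : Fin 2 => if i.val + j.val + 1 = 2 then (1 : L) else 0) (Matrix.of fun i j : Fin 1 => if i.val + j.val + 1 = 1 then (1 : L) else 0) v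
          (Quotient.out (ConjClasses.mk ((UnitaryGroup.cmDatum L 2 (Matrix.of fun i j : Fin 2 => if i.val + j.val + 1 = 2 then (1 : L) else 0)).toAdelic γH.1,
          (UnitaryGroup.cmDatum L 1 (Matrix.of fun i j : Fin 1 => if i.val + j.val + 1 = 1 then (1 : L) else 0)).toAdelic γH.2)) : UnitaryGroup.pairAdelic L (Matrix.of fun i j : Fin 2 => if i.val + j.val + 1 = 2 then (1 : L) else 0) (Matrix.of fun i j : Fin 1 => if i.val + j.val + 1 = 1 then (1 : L) else 0))) Set.univ).toReal : ℂ)) *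
        fH ((UnitaryGroup.cmDatum L 2 (Matrix.of fun i j : Fin 2 => if i.val + j.val + 1 = 2 then (1 : L) else 0)).toAdelic γH.1,
          (UnitaryGroup.cmDatum L 1 (Matrix.of fun i j : Fin 1 => if i.val + j.val + 1 = 1 then (1 : L) else 0)).toAdelic γH.2) := by
  have hcen0 := toAdelic_pair_comm_of_smul_one hγ
  have hout : (Quotient.out (ConjClasses.mk ((UnitaryGroup.cmDatum L 2 (Matrix.of fun i j : Fin 2 => if i.val + j.val + 1 = 2 then (1 : L) else 0)).toAdelic γH.1,
          (UnitaryGroup.cmDatum L 1 (Matrix.of fun i j : Fin 1 => if i.val + j.val + 1 = 1 then (1 : L) else 0)).toAdelic γH.2)) : UnitaryGroup.pairAdelic L (Matrix.of fun i j : Fin 2 => if i.val + j.val + 1 = 2 then (1 : L) else 0) (Matrix.of fun i j : Fin 1 => if i.val + j.val + 1 = 1 then (1 : L) else 0)) =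
      ((UnitaryGroup.cmDatum L 2 (Matrix.of fun i j : Fin 2 => if i.val + j.val + 1 = 2 then (1 : L) else 0)).toAdelic γH.1,
          (UnitaryGroup.cmDatum L 1 (Matrix.of fun i j : Fin 1 => if i.val + j.val + 1 = 1 then (1 : L) else 0)).toAdelic γH.2) :=
    quotientOut_conjClassesMk_eq_of_forall_comm hcen0
  have hcen : ∀ g : UnitaryGroup.pairAdelic L (Matrix.of fun i j : Fin 2 => if i.val + j.val + 1 = 2 then (1 : L) else 0) (Matrix.of fun i j : Fin 1 => if i.val + j.val + 1 = 1 then (1 : L) else 0),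
      g * (Quotient.out (ConjClasses.mk ((UnitaryGroup.cmDatum L 2 (Matrix.of fun i j : Fin 2 => if i.val + j.val + 1 = 2 then (1 : L) else 0)).toAdelic γH.1,
          (UnitaryGroup.cmDatum L 1 (Matrix.of fun i j : Fin 1 => if i.val + j.val + 1 = 1 then (1 : L) else 0)).toAdelic γH.2)) : UnitaryGroup.pairAdelic L (Matrix.of fun i j : Fin 2 => if i.val + j.val + 1 = 2 then (1 : L) else 0) (Matrix.of fun i j : Fin 1 => if i.val + j.val + 1 = 1 then (1 : L) else 0)) =
        (Quotient.out (ConjClasses.mk ((UnitaryGroup.cmDatum L 2 (Matrix.of fun i j : Fin 2 => if i.val + j.val + 1 = 2 then (1 : L) else 0)).toAdelic γH.1,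
          (UnitaryGroup.cmDatum L 1 (Matrix.of fun i j : Fin 1 => if i.val + j.val + 1 = 1 then (1 : L) else 0)).toAdelic γH.2)) : UnitaryGroup.pairAdelic L (Matrix.of fun i j : Fin 2 => if i.val + j.val + 1 = 2 then (1 : L) else 0) (Matrix.of fun i j : Fin 1 => if i.val + j.val + 1 = 1 then (1 : L) else 0)) * g := by
    rw [hout]; exact hcen0
  have hcenv : ∀ (v : HeightOneSpectrum (𝓞 ↥(maximalRealSubfield L))) (g : UnitaryGroup.pairLocal L (Matrix.of fun i j : Fin 2 => if i.val + j.val + 1 = 2 then (1 : L) else 0) (Matrix.of fun i j : Fin 1 => if i.val + j.val + 1 = 1 then (1 : L) else 0) v),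
      g * UnitaryGroup.pairToLocal L (Matrix.of fun i j : Fin 2 => if i.val + j.val + 1 = 2 then (1 : L) else 0) (Matrix.of fun i j : Fin 1 => if i.val + j.val + 1 = 1 then (1 : L) else 0) v
          (Quotient.out (ConjClasses.mk ((UnitaryGroup.cmDatum L 2 (Matrix.of fun i j : Fin 2 => if i.val + j.val + 1 = 2 then (1 : L) else 0)).toAdelic γH.1,
          (UnitaryGroup.cmDatum L 1 (Matrix.of fun i j : Fin 1 => if i.val + j.val + 1 = 1 then (1 : L) else 0)).toAdelic γH.2)) : UnitaryGroup.pairAdelic L (Matrix.of fun i j : Fin 2 => if i.val + j.val + 1 = 2 then (1 : L) else 0) (Matrix.of fun i j : Fin 1 => if i.val + j.val + 1 = 1 then (1 : L) else 0)) =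
        UnitaryGroup.pairToLocal L (Matrix.of fun i j : Fin 2 => if i.val + j.val + 1 = 2 then (1 : L) else 0) (Matrix.of fun i j : Fin 1 => if i.val + j.val + 1 = 1 then (1 : L) else 0) v
          (Quotient.out (ConjClasses.mk ((UnitaryGroup.cmDatum L 2 (Matrix.of fun i j : Fin 2 => if i.val + j.val + 1 = 2 then (1 : L) else 0)).toAdelic γH.1,
          (UnitaryGroup.cmDatum L 1 (Matrix.of fun i j : Fin 1 => if i.val + j.val + 1 = 1 then (1 : L) else 0)).toAdelic γH.2)) : UnitaryGroup.pairAdelic L (Matrix.of fun i j : Fin 2 => if i.val + j.val + 1 = 2 then (1 : L) else 0) (Matrix.of fun i j : Fin 1 => if i.val + j.val + 1 = 1 then (1 : L) else 0)) * g := by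
    intro v g
    rw [hout]
    exact Prod.ext (cmDatum_toLocal_toAdelic_comm_of_smul_one hγ v g.1) (cmDatum_local_comm_fin_one v _ g.2)
  rw [adelicStableOrbitalIntegralH, adelicStableClassesOverH_eq_singleton_of_smul_one hγ, adelicStableOrbitalSum_singleton,
    UnitaryGroup.classOrbitalIntegral_ofLocalAdelicPair_of_forall_comm L (Matrix.of fun i j : Fin 2 => if i.val + j.val + 1 = 2 then (1 : L) else 0) (Matrix.of fun i j : Fin 1 => if i.val + j.val + 1 = 1 then (1 : L) else 0) mH _ mHi hcen hcenv hS₀ hadm hadmA fH, hout]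

end CentralHOfLocal

end Literature.NumberTheory.Rogawski1990
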